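import Literature.AlgebraicGeometry.Morphisms.UnramifiedFiber
import HarnessLib

/-!
# Unramified AT A POINT from the fibre through the point, and through a base change
# ([StacksProject 02G8]; [EGAIV4] 17.4.1) — the pointwise companions of ★ `Morphisms/UnramifiedFiber`

Topic `Literature/AlgebraicGeometry/Morphisms`; namespace `Literature.AlgebraicGeometry.Morphisms`.  PROOF FILE (theorems only; no
definition, no named fact, no instance, no `sorry`; imports ★ `Morphisms/UnramifiedFiber` + Mathlib).  Cell `hodgecm-mathlib` (D-0151),
FLOOR 0, programme F0P5a, (γ3-generic) row **Γ3-E1a-ii, generic half** (F0P5a-plan (g2) desk `Gamma3-DESK.v0.2` :160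
`StalkFormallyUnramifiedOfSpecialFibreOpenImmersion`; with ★ p801384 `Morphisms/EtaleNearOfFormallyUnramifiedStalk` it yields Γ3-E1a).

★ `Morphisms/UnramifiedFiber` (B-p20) proves the GLOBAL fibre criterion: `f` locally of finite type with ALL fibres `X_y → Spec κ(y)`
formally unramified is formally unramified (§2), and descent of fibrewise unramifiedness along base change to residue fields (§3).  Its ring
lemma `Algebra.IsUnramifiedAt.of_formallyUnramified_fiber` is already pointwise.  This file gives the POINTWISE scheme statements:

* §1 `formallyUnramified_stalkMap_of_formallyUnramified_fiber` — **for `f : X ⟶ Y` locally of finite type and `x ∈ X`, if the fibre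
  `X_{f x} → Spec κ(f x)` through `x` is formally unramified then the stalk map `𝒪_{Y, f x} → 𝒪_{X, x}` is formally unramified**
  (affine opens `x ∈ W ⊆ f⁻¹ U₀`; the fibre of `Spec Γ(W) → Spec Γ(U₀)` over the prime of `f x` is a base change of an open piece of
  `X_{f x}` — Mathlib `pullbackRightPullbackFstIso`, `isPullback_fiberToSpecResidueField_of_isPullback` for the monomorphism `U₀ ↪ Y`,
  `Spec.fiberToSpecResidueFieldIso`; then ★ `IsUnramifiedAt.of_formallyUnramified_fiber` and Mathlib `IsAffineOpen.arrowStalkMapIso`).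
* §2 `formallyUnramified_stalkMap_of_isPullback` — **unramifiedness at a point DESCENDS THROUGH A BASE CHANGE**: in a cartesian square
  `X' = X ×_Y Y'` (`IsPullback iX f' f iY`) with `f` locally of finite type, if the fibre of the base change `f'` through a point
  `x' ∈ X'` is formally unramified (e.g. `f'` formally unramified near `x'`), then the stalk map of `f` at `iX x'` is formally unramified
  (the fibre of `f'` at `f' x'` is the base change of the fibre of `f` at `f (iX x')` along the quasi-compact faithfully flat
  `Spec κ(f' x') → Spec κ(f (iX x'))`: fpqc descent, Mathlib `DescendsAlong @FormallyUnramified`); variants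
  `…_of_isPullback_of_formallyUnramified` (`f'` formally unramified) and `…_of_isPullback_of_opens` (`f'` formally unramified on an
  open `V ∋ x'`).

Ours (formalisation glue over Mathlib); axioms `propext`, `Classical.choice`, `Quot.sound`.

## References
* [StacksProject] The Stacks Project, Tag 02G8 (unramified morphisms: fibrewise and pointwise criteria), Tag 00UV.
* [EGAIV4] A. Grothendieck, J. Dieudonné, EGA IV₄ (Publ. Math. IHÉS 32, 1967), Thm. 17.4.1.
-/

set_option autoImplicit false

noncomputable section

open CategoryTheory CategoryTheory.Limits TopologicalSpace AlgebraicGeometry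

namespace Literature.AlgebraicGeometry.Morphisms

universe u

variable {X Y : Scheme.{u}} (f : X ⟶ Y)

/-! ## §1 Unramified at `x` from the fibre through `x` -/

set_option backward.isDefEq.respectTransparency false in
/-- **The pointwise fibre criterion** ([StacksProject 02G8 (1)⇔(3)], [EGAIV4 17.4.1]): for `f : X ⟶ Y` locally of finite type and a point `x`,
if the scheme-theoretic fibre `X_{f x} → Spec κ(f x)` is formally unramified then the stalk map `𝒪_{Y,f x} → 𝒪_{X,x}` is formally unramified.
PROOF: take affine opens `x ∈ W ⊆ f⁻¹ U₀`, `φ := f.appLE U₀ W : R → S`, `𝔭` the prime of `f x`, `𝔮` of `x`.  The fibre of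
`Spec S → Spec R` over `𝔭` is, up to the isomorphism `κ(𝔭) ≅ κ(f x)` (the open immersion `U₀ ↪ Y` is a monomorphism), the fibre over
`f x` of `Spec S ↪ X → Y`, an open piece of `X_{f x}` — so `κ(𝔭) ⊗_R S` is formally unramified over `κ(𝔭)`; ★
`Algebra.IsUnramifiedAt.of_formallyUnramified_fiber` gives `R → S_𝔮` formally unramified, hence `R_𝔭 → S_𝔮`, which IS the stalk map
(Mathlib `IsAffineOpen.arrowStalkMapIso`). [cite: StacksProject, Tag 02G8] [cite: EGAIV4, Thm. 17.4.1] -/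
theorem formallyUnramified_stalkMap_of_formallyUnramified_fiber [LocallyOfFiniteType f] (x : X)
    (h : FormallyUnramified (f.fiberToSpecResidueField (f x))) : (f.stalkMap x).hom.FormallyUnramified := by
  classical
  -- affine opens `x ∈ W ⊆ f ⁻¹ U₀`
  obtain ⟨U₀, hU₀, hfx, -⟩ := Opens.isBasis_iff_nbhd.mp Y.isBasis_affineOpens (Opens.mem_top (f x))
  obtain ⟨W, hW, hxW, e⟩ := Opens.isBasis_iff_nbhd.mp X.isBasis_affineOpens (show x ∈ f ⁻¹ᵁ U₀ from hfx)
  set φ := (f.appLE U₀ W e).hom with hφ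
  algebraize [φ]
  have hft : φ.FiniteType := HasRingHomProperty.appLE @LocallyOfFiniteType f inferInstance ⟨U₀, hU₀⟩ ⟨W, hW⟩ e
  haveI : Algebra.FiniteType Γ(Y, U₀) Γ(X, W) := hft
  -- the primes of `f x` and `x`
  set p := hU₀.primeIdealOf ⟨f x, e hxW⟩ with hp
  set q := hW.primeIdealOf ⟨x, hxW⟩ with hq
  have hpq : q.comap (f.appLE U₀ W e).hom = p := IsAffineOpen.comap_primeIdealOf_appLE U₀ hU₀ W hW e hxW
  haveI : q.asIdeal.LiesOver p.asIdeal := ⟨by rw [← hpq]; rfl⟩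
  -- the point `f x` as `hU₀.fromSpec 𝔭`
  haveI : IsOpenImmersion hU₀.fromSpec := hU₀.isOpenImmersion_fromSpec
  haveI : IsOpenImmersion hW.fromSpec := hW.isOpenImmersion_fromSpec
  have hfp : hU₀.fromSpec p = f x := by
    rw [hp, hU₀.fromSpec_primeIdealOf ⟨f x, e hxW⟩]
  have h₁ : FormallyUnramified (f.fiberToSpecResidueField (hU₀.fromSpec p)) := by
    rw [hfp]
    exact h
  -- (a) the fibre of `Spec S ↪ X → Y` over it is formally unramified (an open piece of the fibre of `f`)
  have ha : FormallyUnramified ((hW.fromSpec ≫ f).fiberToSpecResidueField (hU₀.fromSpec p)) := by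
    rw [Scheme.Hom.fiberToSpecResidueField, ← pullbackRightPullbackFstIso_inv_snd_snd]
    exact MorphismProperty.comp_mem _ _ _ (MorphismProperty.of_isIso _ _)
      (MorphismProperty.comp_mem _ _ _ inferInstance h₁)
  -- (b) ... which is the fibre of `Spec S → Spec R ↪ Y`
  have hb : FormallyUnramified ((Spec.map (f.appLE U₀ W e) ≫ hU₀.fromSpec).fiberToSpecResidueField (hU₀.fromSpec p)) := by
    rw [IsAffineOpen.SpecMap_appLE_fromSpec f hU₀ hW e]
    exact ha
  -- (c) the fibre of `Spec S → Spec R` over `𝔭` is a base change of it (`U₀ ↪ Y` is a monomorphism)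
  have hsq : IsPullback (𝟙 _) (Spec.map (f.appLE U₀ W e)) (Spec.map (f.appLE U₀ W e) ≫ hU₀.fromSpec) hU₀.fromSpec :=
    IsPullback.of_horiz_isIso_mono ⟨by rw [Category.id_comp]⟩
  have hc : FormallyUnramified ((Spec.map (f.appLE U₀ W e)).fiberToSpecResidueField p) :=
    MorphismProperty.of_isPullback (isPullback_fiberToSpecResidueField_of_isPullback hsq p) hb
  -- (d) ring level: `κ(𝔭) ⊗_R S` is formally unramified over `κ(𝔭)`
  haveI : Algebra.FormallyUnramified p.asIdeal.ResidueField (p.asIdeal.Fiber Γ(X, W)) := by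
    have hc' : FormallyUnramified ((Spec.map (CommRingCat.ofHom (algebraMap Γ(Y, U₀) Γ(X, W)))).fiberToSpecResidueField p) := hc
    rw [MorphismProperty.arrow_mk_iso_iff (P := @FormallyUnramified) (Spec.fiberToSpecResidueFieldIso Γ(Y, U₀) Γ(X, W) p),
      HasRingHomProperty.Spec_iff (P := @FormallyUnramified), CommRingCat.hom_ofHom, RingHom.formallyUnramified_algebraMap] at hc'
    exact hc'
  -- (e) ★ pointwise ring criterion, then up to the stalk
  have hq' : Algebra.IsUnramifiedAt Γ(Y, U₀) q.asIdeal :=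
    Algebra.IsUnramifiedAt.of_formallyUnramified_fiber (R := Γ(Y, U₀)) (S := Γ(X, W)) p.asIdeal q.asIdeal
  let Rp := Localization.AtPrime p.asIdeal
  let Sq := Localization.AtPrime q.asIdeal
  have hpq' : p.asIdeal = q.asIdeal.comap (algebraMap Γ(Y, U₀) Γ(X, W)) := (PrimeSpectrum.ext_iff.mp hpq).symm
  letI : Algebra Rp Sq := (Localization.localRingHom p.asIdeal q.asIdeal (algebraMap Γ(Y, U₀) Γ(X, W)) hpq').toAlgebra
  haveI : IsScalarTower Γ(Y, U₀) Rp Sq := IsScalarTower.of_algebraMap_eq fun r => by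
    rw [RingHom.algebraMap_toAlgebra, Localization.localRingHom_to_map, IsScalarTower.algebraMap_apply Γ(Y, U₀) Γ(X, W) Sq]
  haveI : Algebra.FormallyUnramified Rp Sq := Algebra.FormallyUnramified.localization_base (M := p.asIdeal.primeCompl)
  have hloc : (Localization.localRingHom p.asIdeal q.asIdeal (algebraMap Γ(Y, U₀) Γ(X, W)) hpq').FormallyUnramified :=
    RingHom.formallyUnramified_algebraMap.mpr this
  exact (RingHom.FormallyUnramified.respectsIso.arrow_mk_iso_iff (IsAffineOpen.arrowStalkMapIso f U₀ hU₀ W hW e hxW)).mpr hloc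

/-! ## §2 Unramified at a point descends through a base change -/

/-- **Unramifiedness at a point descends through base change** ([StacksProject 02G8] + fpqc descent): in a cartesian square
`IsPullback iX f' f iY` (`X' = X ×_Y Y'`, `f' : X' → Y'` the base change of the locally-finite-type `f : X → Y`), if the fibre of `f'`
through a point `x'` is formally unramified over `κ(f' x')`, then the stalk map of `f` at `iX x'` is formally unramified.  The fibre of
`f'` at `f' x'` is the base change of the fibre of `f` at `f (iX x') = iY (f' x')` along the quasi-compact faithfully flat
`Spec κ(f' x') → Spec κ(iY (f' x'))` (Mathlib `isPullback_fiberToSpecResidueField_of_isPullback`), so the latter fibre is formally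
unramified by descent (Mathlib `DescendsAlong @FormallyUnramified (@Surjective ⊓ @Flat ⊓ @QuasiCompact)`), and §1 concludes.
[cite: StacksProject, Tag 02G8] [cite: EGAIV4, Thm. 17.4.1] -/
theorem formallyUnramified_stalkMap_of_isPullback [LocallyOfFiniteType f] {X' Y' : Scheme.{u}} {f' : X' ⟶ Y'} {iX : X' ⟶ X}
    {iY : Y' ⟶ Y} (hsq : IsPullback iX f' f iY) (x' : X')
    (h : FormallyUnramified (f'.fiberToSpecResidueField (f' x'))) : (f.stalkMap (iX x')).hom.FormallyUnramified := by
  refine formallyUnramified_stalkMap_of_formallyUnramified_fiber f (iX x') ?_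
  have hfx : f (iX x') = iY (f' x') := by
    rw [← Scheme.Hom.comp_apply, hsq.w, Scheme.Hom.comp_apply]
  have hfib := isPullback_fiberToSpecResidueField_of_isPullback hsq (f' x')
  have hQ : (@Surjective ⊓ @Flat ⊓ @QuasiCompact : MorphismProperty Scheme) (Spec.map (iY.residueFieldMap (f' x'))) :=
    ⟨⟨inferInstance, inferInstance⟩, inferInstance⟩
  have key := MorphismProperty.of_isPullback_of_descendsAlong (P := @FormallyUnramified) hfib.flip hQ h
  rw [hfx]
  exact key

/-- The same with `f'` formally unramified outright (its fibres are then formally unramified: base change).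
[cite: StacksProject, Tag 02G8] -/
theorem formallyUnramified_stalkMap_of_isPullback_of_formallyUnramified [LocallyOfFiniteType f] {X' Y' : Scheme.{u}}
    {f' : X' ⟶ Y'} {iX : X' ⟶ X} {iY : Y' ⟶ Y} (hsq : IsPullback iX f' f iY) [FormallyUnramified f'] (x' : X') :
    (f.stalkMap (iX x')).hom.FormallyUnramified :=
  formallyUnramified_stalkMap_of_isPullback f hsq x' (FormallyUnramified.fiberToSpecResidueField f' (f' x'))

/-- **The same with `f'` formally unramified only on a saturated open `iX ⁻¹ O ∋ x'`** (`O ⊆ X` open; e.g. any open of `X'` when `iX`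
is a topological embedding, such as a base change of a closed immersion): restrict the cartesian square to `O`
(Mathlib `isPullback_morphismRestrict` + pasting: `iX ⁻¹ O = O ×_Y Y'`), apply the previous statement to `O ↪ X → Y`, and move the
stalk map back along the open immersion `O ↪ X`. [cite: StacksProject, Tag 02G8] -/
theorem formallyUnramified_stalkMap_of_isPullback_of_opens [LocallyOfFiniteType f] {X' Y' : Scheme.{u}} {f' : X' ⟶ Y'}
    {iX : X' ⟶ X} {iY : Y' ⟶ Y} (hsq : IsPullback iX f' f iY) (O : X.Opens) [FormallyUnramified ((iX ⁻¹ᵁ O).ι ≫ f')]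
    (x' : X') (hx' : x' ∈ iX ⁻¹ᵁ O) : (f.stalkMap (iX x')).hom.FormallyUnramified := by
  -- the square restricted to `O` is cartesian over `O ↪ X → Y`
  have hsqO : IsPullback (iX ∣_ O) ((iX ⁻¹ᵁ O).ι ≫ f') (O.ι ≫ f) iY :=
    (isPullback_morphismRestrict iX O).paste_vert hsq
  have key := formallyUnramified_stalkMap_of_isPullback_of_formallyUnramified (O.ι ≫ f) hsqO ⟨x', hx'⟩
  -- the stalk map of `O ↪ X → Y` at `(iX ∣_ O) x'` is that of `f` at `O.ι ((iX ∣_ O) x') = iX x'` followed by an isomorphism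
  rw [Scheme.Hom.stalkMap_comp] at key
  have key₂ := (RingHom.FormallyUnramified.respectsIso.cancel_right_isIso _ _).mp key
  have hpt : O.ι ((iX ∣_ O) ⟨x', hx'⟩) = iX x' := by
    rw [← Scheme.Hom.comp_apply, morphismRestrict_ι, Scheme.Hom.comp_apply]
    rfl
  exact (RingHom.FormallyUnramified.respectsIso.arrow_mk_iso_iff (f.arrowStalkMapIsoOfEq hpt)).mp key₂

end Literature.AlgebraicGeometry.Morphisms

end
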